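import Literature.Claims.NS.Harbeck2025
import Literature.Analysis.FluidPDE.TorusABCFlow
import Literature.Analysis.FluidPDE.TorusClassicalHnBalance
import Literature.Analysis.FunctionSpaces.TorusTestFunction
import Mathlib.Analysis.SpecialFunctions.ExpDeriv
import HarnessLib

/-!
# C87 `Harbeck2025` — kernel certificate for the NS-claims sweep (D-0090)

Kill kit written by typist-7 g2 (claims/Harbeck2025/typist7-killkit-Harbeck2025.lean, sha16 98fc419f015da47e),
adopted by the refuter of record (refuter-8 g0) with the refuted statements written fully qualified; no
mathematical change. Typed record: `Literature.Claims.NS.Harbeck2025` (typist-7 g2, p484827).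
Nothing here is a claim about NS regularity or blow-up.

* `not_Step_osgood` — the a-priori decay law (Step IX p.330 = (1.15) p.19 = (1.17) of Theorem 1.1
  p.20: `d/dt‖u‖²_{H¹} ≤ −γ‖u‖²_{H¹} log(e + ‖u‖_{H¹})`, `γ = γ(ν)`) FAILS at `ν = 1` along the exact
  ABC solution `u(t) = e^{−4π²t}·abcFlow a a a` of large amplitude `a`: its `H¹` norm squared is
  `K e^{−8π²t}`, `K = 3a²(1 + 4π²)`, decaying at the FIXED rate `8π²`, while (1.17) demands the rate
  `γ log(e + ‖u(1)‖_{H¹}) > 8π²` once `a = exp(8π²/γ + 4π²)`.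
* `not_ClaimedTheoremT3` — hence Theorem 1.1 AS PRINTED (with (1.17)) is false, by the skeleton's
  uniqueness transport `not_claimedT3_of_not_osgood`.

WHAT THIS IS NOT: not a claim about NS regularity or blow-up; not a claim about any author beyond the
typed locator.
-/

set_option linter.dupNamespace false

open MeasureTheory Set
open scoped InnerProductSpace RealInnerProductSpace

namespace Summit.NavierStokesRegularity.NavierStokesRegularity.Theorems.Harbeck2025

open Literature.Claims.NS.Harbeck2025
open Literature.Analysis.FunctionSpaces Literature.Analysis.FluidPDE

noncomputable section

/-! ## The `H¹` history of the viscous ABC flow -/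

/-- `‖∇(abcFlow)‖₂² = 4π²(A² + B² + C²)` (first Laplacian shell: `∫⟪Δw, w⟫ = −‖∇w‖₂²` with
`Δw = −4π²w` and `∫‖w‖² = A² + B² + C²`). [cite: MajdaBertozziCUP2002, §2.3.2 Example 2.8] -/
theorem gradNormSq_abcFlow (A B C : ℝ) :
    Torus.gradNormSq (Torus.abcFlow A B C) = 4 * Real.pi ^ 2 * (A ^ 2 + B ^ 2 + C ^ 2) := by
  have h := Torus.integral_inner_laplacian_self_eq_neg_gradNormSq (Torus.isSmooth_abcFlow A B C)
  have h2 : ∫ x, ⟪Torus.laplacian (Torus.abcFlow A B C) x, Torus.abcFlow A B C x⟫ =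
      -(4 * Real.pi ^ 2) * ∫ x, ‖Torus.abcFlow A B C x‖ ^ 2 := by
    rw [← integral_const_mul]
    refine integral_congr_ae (ae_of_all _ fun x => ?_)
    dsimp only
    rw [Torus.laplacian_abcFlow, inner_neg_left, real_inner_smul_left, real_inner_self_eq_norm_sq]
    ring
  rw [h2, Torus.integral_norm_sq_abcFlow] at h
  linarith

/-- `‖∇(c • w)‖₂² = c² ‖∇w‖₂²` for smooth `w`. [folklore] -/
private theorem gradNormSq_const_smul {w : UnitAddTorus (Fin 3) → EuclideanSpace ℝ (Fin 3)}
    (hw : Torus.IsSmooth w) (c : ℝ) :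
    Torus.gradNormSq (c • w) = c ^ 2 * Torus.gradNormSq w := by
  unfold Torus.gradNormSq
  rw [← integral_const_mul]
  refine integral_congr_ae (ae_of_all _ fun x => ?_)
  dsimp only
  rw [Finset.mul_sum]
  refine Finset.sum_congr rfl fun i _ => ?_
  rw [Torus.partialDeriv_const_smul (hw.isContDiff (by norm_cast)) c i, Pi.smul_apply,
    norm_smul, mul_pow, Real.norm_eq_abs, sq_abs]

/-- The viscous ABC trajectory at `ν = 1`: `u(t) = e^{−4π²t} · abcFlow A B C`, written exactly as in
`Torus.isClassicalNSSolutionOn_abcFlow`. [cite: MajdaBertozziCUP2002, §2.3.2 p. 61] -/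
def abcNS (A B C : ℝ) : ℝ → UnitAddTorus (Fin 3) → EuclideanSpace ℝ (Fin 3) :=
  fun t x => Real.exp (-(1 * (2 * Real.pi) ^ 2) * t) • Torus.abcFlow A B C x

/-- Its Bernoulli pressure. [cite: MajdaBertozziCUP2002, §2.3.2 p. 61] -/
def abcP (A B C : ℝ) : ℝ → UnitAddTorus (Fin 3) → ℝ :=
  fun t x => (-(Real.exp (-(1 * (2 * Real.pi) ^ 2) * t) ^ 2)) * (‖Torus.abcFlow A B C x‖ ^ 2 / 2)

/-- The viscous ABC trajectory is an exact global classical solution at `ν = 1` (tree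
`Torus.isClassicalNSSolutionOn_abcFlow`). [cite: MajdaBertozziCUP2002, §2.3.2 p. 61] -/
theorem isClassicalNSSolutionOn_abcNS (A B C : ℝ) :
    Torus.IsClassicalNSSolutionOn (Ici 0) 1 0 (abcNS A B C) (abcP A B C) :=
  Torus.isClassicalNSSolutionOn_abcFlow 1 A B C

/-- The amplitude-squared constant `K = (1 + 4π²)(A² + B² + C²)` of the `H¹` history. [folklore] -/
def Kconst (A B C : ℝ) : ℝ := (1 + 4 * Real.pi ^ 2) * (A ^ 2 + B ^ 2 + C ^ 2)

/-- `‖u(t)‖²_{H¹} = K · e^{−8π²t}` along the viscous ABC flow. [cite: MajdaBertozziCUP2002, §2.3.2 Example 2.8] -/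
theorem h1NormSq_abcNS (A B C t : ℝ) :
    h1NormSq (abcNS A B C t) = Kconst A B C * Real.exp (-(8 * Real.pi ^ 2) * t) := by
  set c : ℝ := Real.exp (-(1 * (2 * Real.pi) ^ 2) * t) with hc
  have hslice : abcNS A B C t = c • Torus.abcFlow A B C := by
    funext x; rfl
  have hc2 : c ^ 2 = Real.exp (-(8 * Real.pi ^ 2) * t) := by
    rw [hc, ← Real.exp_nat_mul]; congr 1; push_cast; ring
  unfold h1NormSq
  rw [hslice, gradNormSq_const_smul (Torus.isSmooth_abcFlow A B C) c, gradNormSq_abcFlow]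
  have hL2 : ∫ x, ‖(c • Torus.abcFlow A B C) x‖ ^ 2 = c ^ 2 * (A ^ 2 + B ^ 2 + C ^ 2) := by
    rw [← Torus.integral_norm_sq_abcFlow A B C, ← integral_const_mul]
    refine integral_congr_ae (ae_of_all _ fun x => ?_)
    dsimp only
    rw [Pi.smul_apply, norm_smul, mul_pow, Real.norm_eq_abs, sq_abs]
  rw [hL2, hc2, Kconst]
  ring

/-- The derivative of the `H¹` history: `d/dt (K e^{−8π²t}) = −8π² K e^{−8π²t}`. [folklore] -/
theorem deriv_h1NormSq_abcNS (A B C t : ℝ) :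
    deriv (fun s => h1NormSq (abcNS A B C s)) t =
      -(8 * Real.pi ^ 2) * (Kconst A B C * Real.exp (-(8 * Real.pi ^ 2) * t)) := by
  have hfun : (fun s => h1NormSq (abcNS A B C s)) =
      fun s => Kconst A B C * Real.exp (-(8 * Real.pi ^ 2) * s) := by
    funext s; exact h1NormSq_abcNS A B C s
  rw [hfun]
  have hd : HasDerivAt (fun s => Kconst A B C * Real.exp (-(8 * Real.pi ^ 2) * s))
      (Kconst A B C * (Real.exp (-(8 * Real.pi ^ 2) * t) * (-(8 * Real.pi ^ 2)))) t := by
    have h1 : HasDerivAt (fun s => -(8 * Real.pi ^ 2) * s) (-(8 * Real.pi ^ 2)) t := by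
      simpa using (hasDerivAt_id t).const_mul (-(8 * Real.pi ^ 2))
    exact (h1.exp).const_mul _
  rw [hd.deriv]
  ring

/-- The initial slice has zero mean. [cite: MajdaBertozziCUP2002, §2.3.2 Example 2.8] -/
theorem hasZeroMean_abcNS_zero (A B C : ℝ) : Torus.HasZeroMean (abcNS A B C 0) := by
  have h0 : abcNS A B C 0 = Torus.abcFlow A B C := by
    funext x; simp [abcNS]
  rw [h0]
  exact Torus.hasZeroMean_abcFlow A B C

/-! ## The kill -/

/-- **Step 1 fails** (Step IX p.330 / (1.15) p.19 / (1.17) p.20): at `ν = 1`, whatever `γ > 0`, the ABC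
solution with `A = B = C = a := exp(8π²/γ + 4π²)` violates
`d/dt‖u‖²_{H¹} ≤ −γ‖u‖²_{H¹}log(e + ‖u‖_{H¹})` at `t = 1`: the left side is `−8π²·X`, the right side is
`−γ X log(e + √X)` with `√X ≥ exp(8π²/γ)`, i.e. `γ log(e + √X) > 8π²`.
[cite: Harbeck2025, Theorem 1.1 (1.17) p.20; Step IX p.330] -/
theorem not_Step_osgood : ¬ Literature.Claims.NS.Harbeck2025.Step_osgood := by
  intro h
  obtain ⟨γ, hγ, hall⟩ := h 1 one_pos
  set a : ℝ := Real.exp (8 * Real.pi ^ 2 / γ + 4 * Real.pi ^ 2) with ha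
  have hdecay := hall (abcNS a a a) (abcP a a a) (isClassicalNSSolutionOn_abcNS a a a)
    (hasZeroMean_abcNS_zero a a a) 1 one_pos
  rw [deriv_h1NormSq_abcNS, h1NormSq_abcNS] at hdecay
  -- abbreviate X = K e^{-8π²} and L = log(e + √X)
  set X : ℝ := Kconst a a a * Real.exp (-(8 * Real.pi ^ 2) * 1) with hX
  set L : ℝ := Real.log (Real.exp 1 + Real.sqrt X) with hL
  have hpi : 0 < Real.pi ^ 2 := by positivity
  have hK : Kconst a a a = 3 * (1 + 4 * Real.pi ^ 2) * a ^ 2 := by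
    rw [Kconst]; ring
  have ha2 : a ^ 2 = Real.exp (16 * Real.pi ^ 2 / γ + 8 * Real.pi ^ 2) := by
    rw [ha, ← Real.exp_nat_mul]; congr 1; push_cast; ring
  have hXval : X = 3 * (1 + 4 * Real.pi ^ 2) * Real.exp (16 * Real.pi ^ 2 / γ) := by
    have hee : Real.exp (16 * Real.pi ^ 2 / γ + 8 * Real.pi ^ 2) * Real.exp (-(8 * Real.pi ^ 2) * 1) =
        Real.exp (16 * Real.pi ^ 2 / γ) := by
      rw [← Real.exp_add]; congr 1; ring
    rw [hX, hK, ha2, mul_assoc, hee]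
  have hXpos : 0 < X := by rw [hXval]; positivity
  -- (exp(8π²/γ))² ≤ X, hence exp(8π²/γ) ≤ √X
  have hsq : Real.exp (8 * Real.pi ^ 2 / γ) ^ 2 ≤ X := by
    have h3 : (1 : ℝ) ≤ 3 * (1 + 4 * Real.pi ^ 2) := by nlinarith
    have hexp : Real.exp (8 * Real.pi ^ 2 / γ) ^ 2 = Real.exp (16 * Real.pi ^ 2 / γ) := by
      rw [← Real.exp_nat_mul]; congr 1; push_cast; ring
    rw [hexp, hXval]
    calc Real.exp (16 * Real.pi ^ 2 / γ) = 1 * Real.exp (16 * Real.pi ^ 2 / γ) := (one_mul _).symm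
      _ ≤ 3 * (1 + 4 * Real.pi ^ 2) * Real.exp (16 * Real.pi ^ 2 / γ) :=
        mul_le_mul_of_nonneg_right h3 (Real.exp_pos _).le
  have hsqrt : Real.exp (8 * Real.pi ^ 2 / γ) ≤ Real.sqrt X :=
    calc Real.exp (8 * Real.pi ^ 2 / γ) = Real.sqrt (Real.exp (8 * Real.pi ^ 2 / γ) ^ 2) :=
        (Real.sqrt_sq (Real.exp_pos _).le).symm
      _ ≤ Real.sqrt X := Real.sqrt_le_sqrt hsq
  -- log(e + √X) > 8π²/γ, so γ L > 8π²
  have hlog : 8 * Real.pi ^ 2 / γ < L := by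
    have h1 : 8 * Real.pi ^ 2 / γ ≤ Real.log (Real.sqrt X) := by
      rw [← Real.log_exp (8 * Real.pi ^ 2 / γ)]
      exact Real.log_le_log (Real.exp_pos _) hsqrt
    have h2 : Real.log (Real.sqrt X) < L :=
      Real.log_lt_log (lt_of_lt_of_le (Real.exp_pos _) hsqrt) (by linarith [Real.exp_pos (1 : ℝ)])
    exact lt_of_le_of_lt h1 h2
  have hγL : 8 * Real.pi ^ 2 < γ * L := by
    have h1 := mul_lt_mul_of_pos_left hlog hγ
    have h2 : γ * (8 * Real.pi ^ 2 / γ) = 8 * Real.pi ^ 2 := by field_simp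
    linarith
  -- the printed inequality reads  -8π²·X ≤ -(γ·X·L), i.e. γ·X·L ≤ 8π²·X; but 8π²·X < γ·X·L
  have key : γ * X * L ≤ 8 * Real.pi ^ 2 * X := by linarith
  have key2 : 8 * Real.pi ^ 2 * X < γ * X * L := by
    have h1 := mul_lt_mul_of_pos_right hγL hXpos
    have h2 : γ * L * X = γ * X * L := by ring
    linarith
  exact absurd key (not_le.2 key2)

/-- **Theorem 1.1 as printed (with (1.17)) is false** (uniqueness transport in the skeleton).
[cite: Harbeck2025, Theorem 1.1 p.20] -/
theorem not_ClaimedTheoremT3 : ¬ Literature.Claims.NS.Harbeck2025.ClaimedTheoremT3 :=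
  not_claimedT3_of_not_osgood not_Step_osgood

end

end Summit.NavierStokesRegularity.NavierStokesRegularity.Theorems.Harbeck2025
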